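import Literature.AlgebraicGeometry.Frobenioids.UnitLinearFrobenius
import Literature.AlgebraicGeometry.Frobenioids.NaiveFrobeniusFunctorLifts
import Mathlib.CategoryTheory.Whiskering
import HarnessLib

/-!
# Frobenioids I, Corollary 2.6 (unit-wise Frobenius functors), part 1: the functor, (a) and (c)

Mochizuki, *The geometry of Frobenioids I: the general theory*, Kyushu J. Math. **62** (2008)
293–400, §2, Corollary 2.6 and its proof, kurims text pp. 50–51
[cite: MochizukiFrdI2008, Cor. 2.6 p.50].

Proof (p. 51): "the naive Frobenius functor `C → C` associated to `d` [cf. Proposition 2.1, (i)]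
factors naturally through the subcategory `C(d) ⊆ C` [cf. Proposition 2.1, (ii); Definition 2.4,
(iii)]; write `Ψ₁ : C → C(d)` for the resulting functor.  Next, let us write `Ψ₂ : C(d) → C` for
some quasi-inverse functor to the unit-linear Frobenius functor … Set `Ψ := Ψ₂ ∘ Ψ₁ : C → C`.
Then it follows immediately from Propositions 2.1, (ii); 2.5, (iii), (b), that `Ψ` satisfies
property (a)."

This file (with `HasFrobeniusLifts` from `NaiveFrobeniusFunctorLifts.lean`, Prop. 1.10 (i)): the lift
`Ψ₁ : C → C(d)` of the naive Frobenius functor (`naiveFrobeniusCd`); the unit-wise Frobenius functor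
`Ψ := Ψ₁ ⋙ Ψ_ul⁻¹` (`unitWiseFrobenius`; `Ψ_ul⁻¹ := Functor.inv` of the equivalence of Prop. 2.5
(iii)); cancellation of the Frobenius functor of `F_Φ` in natural isomorphisms
(`natIsoOfCompFrobenius`: it is the identity on objects, faithful, and fixes the isomorphisms of
`F_Φ` since the `Φ(A)` are sharp); property **(a)** (`unitWiseFrobenius_oneCommutes`); and property
**(c)** (`unitWiseFrobenius_units`: `Ψ(A) ≅ A` for isotropic `A` conjugating `Ψ` on `O^×(A)` into
`u ↦ u^d`, by Prop. 2.1 (ii) "Moreover" on the Frobenius-trivial object `A`, Prop. 2.5 (ii)).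
-/

noncomputable section

namespace Literature.AlgebraicGeometry.Frobenioids

open CategoryTheory Opposite

universe w v v' u u'

namespace ElemFrobenioid

variable {D : Type u} [Category.{v} D] {Φ : Dᵒᵖ ⥤ CommMonCat.{w}}

/-- In `F_Φ` with `Φ` sharp (objectwise), an isomorphism has zero divisor `0`.
[cite: MochizukiFrdI2008, Def. 1.1(iii) p.20] -/
theorem div_eq_one_of_isIso (hΦ : ∀ A : D, IsSharp (Φ.obj (op A))) {X Y : ElemFrobenioid Φ}
    (φ : X ⟶ Y) [IsIso φ] : Div φ = 1 :=
  (hΦ X.base).1 _ (PreFrobenioid.isUnit_div_of_isIso (𝟭 (ElemFrobenioid Φ)) φ)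

/-- The Frobenius functor of degree `d` fixes the arrows with zero divisor `0`.
[cite: MochizukiFrdI2008, Def. 2.4(iii) p.48] -/
theorem frobenius_map_eq_self (d : ℕ+) {X Y : ElemFrobenioid Φ} {φ : X ⟶ Y} (hφ : Div φ = 1) :
    (frobenius Φ d).map φ = φ :=
  Hom.ext rfl (by show Div ((frobenius Φ d).map φ) = Div φ; rw [div_frobenius_map, hφ, one_pow]) rfl

/-- The Frobenius functor of degree `d` is faithful when `x ↦ d · x` is injective on each `Φ(A)`.
[cite: MochizukiFrdI2008, Def. 2.4(iii) p.48] -/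
theorem frobenius_map_injective (d : ℕ+) (hinj : ∀ A : Dᵒᵖ, Function.Injective ((powEnd Φ d).app A).hom)
    {X Y : ElemFrobenioid Φ} {φ ψ : X ⟶ Y} (h : (frobenius Φ d).map φ = (frobenius Φ d).map ψ) :
    φ = ψ := by
  have hb : Base ((frobenius Φ d).map φ) = Base ((frobenius Φ d).map ψ) := by rw [h]
  have hd : Div ((frobenius Φ d).map φ) = Div ((frobenius Φ d).map ψ) := by rw [h]
  have hn : degFr ((frobenius Φ d).map φ) = degFr ((frobenius Φ d).map ψ) := by rw [h]
  rw [base_frobenius_map, base_frobenius_map] at hb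
  rw [div_frobenius_map, div_frobenius_map] at hd
  rw [degFr_frobenius_map, degFr_frobenius_map] at hn
  exact Hom.ext hb (hinj (op X.base) hd) hn

/-- **Cancellation of the Frobenius functor** in natural isomorphisms: for `Φ` sharp with
`x ↦ d · x` injective, `G ⋙ frob_d ≅ H ⋙ frob_d` yields `G ≅ H` (same components: `frob_d` is the
identity on objects and on isomorphisms, and is faithful). [cite: MochizukiFrdI2008, Cor. 2.6 p.51] -/
def natIsoOfCompFrobenius {E : Type*} [Category E] (d : ℕ+) (hΦ : ∀ A : D, IsSharp (Φ.obj (op A)))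
    (hinj : ∀ A : Dᵒᵖ, Function.Injective ((powEnd Φ d).app A).hom) {G H : E ⥤ ElemFrobenioid Φ}
    (M : G ⋙ frobenius Φ d ≅ H ⋙ frobenius Φ d) : G ≅ H :=
  NatIso.ofComponents (fun X => (M.app X : G.obj X ≅ H.obj X)) (by
    intro X Y f
    apply frobenius_map_injective d hinj
    rw [Functor.map_comp, Functor.map_comp]
    erw [frobenius_map_eq_self d (div_eq_one_of_isIso hΦ (M.app Y).hom),
      frobenius_map_eq_self d (div_eq_one_of_isIso hΦ (M.app X).hom)]
    exact M.hom.naturality f)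

end ElemFrobenioid

namespace PreFrobenioid

variable {D : Type u} [Category.{v} D] {Φ : Dᵒᵖ ⥤ CommMonCat.{w}}
  {C : Type u'} [Category.{v'} C] {F : C ⥤ ElemFrobenioid Φ}

/-! ### `Ψ₁ : C → C(d)` -/

variable {d : ℕ+} (ch : FrobeniusChoice F d) (h : HasFrobeniusLifts F d)

/-- `Div(φ') ∈ d · Φ` for the Frobenius conjugate `φ'` (`α^* Div φ' = d · Div φ`, Prop. 1.10 (i)):
the naive Frobenius functor lands in `C(d)`. [cite: MochizukiFrdI2008, Cor. 2.6 p.51] -/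
theorem divIn_lift {A B : C} (φ : A ⟶ B) : divIn F (powEnd Φ d) (ch.lift h φ) := by
  haveI : IsIso (Base F (ch.hom A)) := (ch.isFrobeniusType A).2
  refine ⟨pull Φ (inv (Base F (ch.hom A))) (Div F φ), ?_⟩
  show (pull Φ (inv (Base F (ch.hom A))) (Div F φ)) ^ (d : ℕ) = Div F (ch.lift h φ)
  apply pull_injective_of_isIso Φ (Base F (ch.hom A))
  rw [map_pow, ← pull_comp, IsIso.hom_inv_id, pull_id, ch.pull_div_lift h φ]

/-- **`Ψ₁ : C → C(d)`**: "the naive Frobenius functor … factors naturally through the subcategory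
`C(d) ⊆ C`". [cite: MochizukiFrdI2008, Cor. 2.6 p.51] -/
def naiveFrobeniusCd : C ⥤ Cd F (powEnd Φ d) where
  obj A := ⟨ch.obj A⟩
  map φ := ⟨ch.lift h φ, divIn_lift ch h φ⟩
  map_id A := InducedWideCategory.Hom.ext ((naiveFrobenius ch h).map_id A)
  map_comp φ ψ := InducedWideCategory.Hom.ext ((naiveFrobenius ch h).map_comp φ ψ)

/-- `Ψ₁` followed by `C(d) ⊆ C` is the naive Frobenius functor. [cite: MochizukiFrdI2008, Cor. 2.6 p.51] -/
theorem naiveFrobeniusCd_comp_inclusion :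
    naiveFrobeniusCd ch h ⋙ wideSubcategoryInclusion (divIn F (powEnd Φ d)) = naiveFrobenius ch h := rfl

namespace CharacteristicSplitting

variable (hF : IsFrobenioid F) (τ : CharacteristicSplitting F) (hmt : IsOfType (IsMetricallyTrivial F))
  (haa : IsOfType (IsAutAmple F)) (hnorm : IsOfType (IsFrobeniusNormalized F)) (d : ℕ+)
  (ch : FrobeniusChoice F d)

set_option quotPrecheck false in
/-- The unit-linear Frobenius functor `Ψ_ul : C → C(d)` of degree `d` (notation local to this file). -/
local notation "Ψul" => (unitLinearFrobeniusData hF τ hmt haa (powEnd Φ d) hnorm).functor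

/-- `Ψ_ul` is an equivalence (Prop. 2.5 (iii)). [cite: MochizukiFrdI2008, Prop. 2.5(iii) p.49] -/
theorem isEquivalence_unitLinear : (Ψul).IsEquivalence :=
  unitLinearFrobeniusData_isEquivalence hF τ hmt haa (powEnd Φ d) hnorm
    (powEnd_app_injective hF.isPreFrobenioid d)

/-- The `1`-compatibility isomorphism of Prop. 2.5 (iii)(b) as data (identity components).
[cite: MochizukiFrdI2008, Prop. 2.5(iii) p.49] -/
def unitLinearCompatIso :
    Ψul ⋙ (wideSubcategoryInclusion (divIn F (powEnd Φ d)) ⋙ F) ≅ F ⋙ ElemFrobenioid.frobenius Φ d :=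
  NatIso.ofComponents (fun A => Iso.refl _) fun {A B} φ => by
    have key : F.map (unitLinearMap hF τ hmt haa (powEnd Φ d) hnorm φ) =
        (ElemFrobenioid.frobenius Φ d).map (F.map φ) :=
      ElemFrobenioid.Hom.ext (base_unitLinearMap hF τ hmt haa _ hnorm φ)
        (div_unitLinearMap hF τ hmt haa _ hnorm φ) (degFr_unitLinearMap hF τ hmt haa _ hnorm φ)
    show F.map (unitLinearMap hF τ hmt haa (powEnd Φ d) hnorm φ) ≫ 𝟙 (F.obj B) =
      𝟙 (F.obj A) ≫ (ElemFrobenioid.frobenius Φ d).map (F.map φ)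
    rw [Category.comp_id]
    exact key.trans (Category.id_comp _).symm

/-- **The unit-wise Frobenius functor `Ψ := Ψ₂ ∘ Ψ₁ : C → C`**, with `Ψ₂ := Ψ_ul⁻¹` a quasi-inverse
of the unit-linear Frobenius functor. [cite: MochizukiFrdI2008, Cor. 2.6 p.51] -/
def unitWiseFrobenius : C ⥤ C :=
  naiveFrobeniusCd ch (hasFrobeniusLifts hF d) ⋙
    @Functor.inv _ _ _ _ Ψul (isEquivalence_unitLinear hF τ hmt haa hnorm d)

/-- `Ψ` on objects: `Ψ(A) = Ψ_ul⁻¹(A')`. [cite: MochizukiFrdI2008, Cor. 2.6 p.51] -/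
theorem unitWiseFrobenius_obj (A : C) :
    (unitWiseFrobenius hF τ hmt haa hnorm d ch).obj A =
      (@Functor.inv _ _ _ _ Ψul (isEquivalence_unitLinear hF τ hmt haa hnorm d)).obj
        ((Ψul).obj (ch.obj A)) := rfl

/-! ### (a): `Ψ` is `1`-compatible with the identity of `F_Φ` -/

/-- The isomorphism `F ⋙ frob_d ≅ (Ψ ⋙ F) ⋙ frob_d` assembled from Prop. 2.1 (ii) (`Ψ₁`) and
Prop. 2.5 (iii)(b) (`Ψ_ul`, through its quasi-inverse). [cite: MochizukiFrdI2008, Cor. 2.6 p.51] -/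
def unitWiseFrobeniusFrobIso :
    F ⋙ ElemFrobenioid.frobenius Φ d ≅
      (unitWiseFrobenius hF τ hmt haa hnorm d ch ⋙ F) ⋙ ElemFrobenioid.frobenius Φ d :=
  letI := isEquivalence_unitLinear hF τ hmt haa hnorm d
  let e := (Ψul).asEquivalence
  let incl := wideSubcategoryInclusion (divIn F (powEnd Φ d))
  -- `incl ⋙ F ≅ Ψ_ul⁻¹ ⋙ (F ⋙ frob)`
  let E₁ : incl ⋙ F ≅ e.inverse ⋙ (F ⋙ ElemFrobenioid.frobenius Φ d) :=
    (Functor.leftUnitor (incl ⋙ F)).symm ≪≫ Functor.isoWhiskerRight e.counitIso.symm (incl ⋙ F) ≪≫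
      Functor.associator _ _ _ ≪≫
        Functor.isoWhiskerLeft e.inverse (unitLinearCompatIso hF τ hmt haa hnorm d)
  naiveFrobeniusCompatIso ch (hasFrobeniusLifts hF d) ≪≫
    Functor.isoWhiskerLeft (naiveFrobeniusCd ch (hasFrobeniusLifts hF d)) E₁ ≪≫
      (Functor.associator _ _ _).symm ≪≫ (Functor.associator _ _ _).symm

/-- **Cor. 2.6 (a)**: `Ψ` is `1`-compatible, relative to `C → F_Φ`, with the identity functor on `F_Φ`
(cancel the Frobenius functor in `unitWiseFrobeniusFrobIso`). [cite: MochizukiFrdI2008, Cor. 2.6 p.50] -/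
theorem unitWiseFrobenius_oneCommutes :
    OneCommutes (unitWiseFrobenius hF τ hmt haa hnorm d ch) F F (𝟭 (ElemFrobenioid Φ)) :=
  ⟨(ElemFrobenioid.natIsoOfCompFrobenius d (fun A => (hF.isPreFrobenioid.isDivisorial A).isSharp)
      (powEnd_app_injective hF.isPreFrobenioid d) (unitWiseFrobeniusFrobIso hF τ hmt haa hnorm d ch)).symm ≪≫
    (Functor.rightUnitor F).symm⟩

/-! ### (c): `Ψ` on `O^×(A)` for isotropic `A` -/

/-- Powers in `Aut A` project to powers in `End A`. [cite: MochizukiFrdI2008, Cor. 2.6 p.50] -/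
theorem aut_pow_hom {A : C} (u : Aut A) (n : ℕ) :
    (u ^ n).hom = @HPow.hPow (End A) ℕ (End A) instHPow u.hom n := by
  induction n with
  | zero => rfl
  | succ n ih =>
    rw [pow_succ, pow_succ, Aut.Aut_mul_def, Iso.trans_hom, ih]
    rfl

/-- The quasi-inverse on the image of an endomorphism, conjugated back by the unit of the
equivalence: `η ; Ψ_ul⁻¹(Ψ_ul f) ; η⁻¹ = f`. [cite: MochizukiFrdI2008, Cor. 2.6 p.51] -/
theorem unit_inv_map_map {X : C} (f : X ⟶ X) :
    letI := isEquivalence_unitLinear hF τ hmt haa hnorm d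
    ((Ψul).asEquivalence.unitIso.app X).hom ≫ (Ψul).inv.map ((Ψul).map f) ≫
      ((Ψul).asEquivalence.unitIso.app X).inv = f := by
  letI := isEquivalence_unitLinear hF τ hmt haa hnorm d
  erw [Functor.inv_fun_map, Category.assoc, Category.assoc]
  rw [Iso.app_hom, Iso.app_inv]
  erw [Iso.hom_inv_id_app_assoc, Iso.hom_inv_id_app, Category.comp_id]

/-- **Cor. 2.6 (c)**: for `A ∈ Ob(C^istr)` there is an isomorphism `Ψ(A) ≅ A` such that "the
endomorphism of `O^×(A)` induced by `Ψ` followed by conjugation by this isomorphism is given by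
raising to the `d`-th power": `A` is Frobenius-trivial (Prop. 2.5 (ii)), the chosen `α_A : A → A'`
is `ζ_A(d)` up to an isomorphism `A' ≅ A` (Def. 1.3 (ii)), `Ψ₁(u) = α_A ∘ u ∘ α_A⁻¹`-conjugate is
`u^d` (Prop. 2.1 (ii) "Moreover", Frobenius-normalisation), and `Ψ_ul⁻¹` fixes the isometry `Ψ₁(u)`
up to the unit of the equivalence. [cite: MochizukiFrdI2008, Cor. 2.6 p.50] -/
theorem unitWiseFrobenius_units {A : C} (hA : IsIsotropic F A) :
    ∃ e : (unitWiseFrobenius hF τ hmt haa hnorm d ch).obj A ≅ A, ∀ u ∈ unitsSubgroup F A,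
      e.inv ≫ (unitWiseFrobenius hF τ hmt haa hnorm d ch).map u.hom ≫ e.hom = (u ^ (d : ℕ)).hom := by
  letI := isEquivalence_unitLinear hF τ hmt haa hnorm d
  have hP := hF.isPreFrobenioid
  have hl := hasFrobeniusLifts hF d
  -- `A` is Frobenius-trivial; `α_A ; e₀ = ζ_A(d)` for an isomorphism `e₀ : A' ≅ A`
  obtain ⟨ζ, hζ⟩ := (isFrobeniusTrivial_istr_iff hF ⟨A, hA⟩).mp
    (isOfType_isFrobeniusTrivial_istr hF hmt ⟨A, hA⟩)
  obtain ⟨hζd, hζb, hζf⟩ := hζ d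
  obtain ⟨e₀, he₀⟩ := hF.ii_unique (ch.hom A) (ζ d : A ⟶ A) (ch.isFrobeniusType A) hζf
    ((ch.degFr_eq A).trans hζd.symm)
  refine ⟨((Ψul).asEquivalence.unitIso.app (ch.obj A)).symm ≪≫ e₀, fun u hu => ?_⟩
  -- `Ψ₁(u)` is an isometry, so `Ψ_ul(Ψ₁ u) = Ψ₁ u`
  have hlift_iso : IsIsometry F (ch.lift hl u.hom) :=
    IsIsometry.frobeniusConjugate (isIsometry_of_isIso F hP u.hom) (ch.hom_lift hl u.hom)
      (ch.isFrobeniusType A) (ch.isFrobeniusType A)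
  have hmap : (naiveFrobeniusCd ch hl).map u.hom = (Ψul).map (ch.lift hl u.hom) :=
    InducedWideCategory.Hom.ext (unitLinearMap_of_isIsometry hF τ hmt haa _ hnorm hlift_iso).symm
  -- `e₀⁻¹ ; Ψ₁(u) ; e₀ = u^d`
  have hconj : e₀.inv ≫ ch.lift hl u.hom ≫ e₀.hom = (u ^ (d : ℕ)).hom := by
    haveI := hP.isTotallyEpimorphic.epi (ζ d : A ⟶ A)
    rw [← cancel_epi (ζ d : A ⟶ A), ← he₀, Category.assoc, e₀.hom_inv_id_assoc, ← Category.assoc,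
      ch.hom_lift hl u.hom, Category.assoc, he₀, aut_pow_hom]
    have hn := hnorm A (ζ d) hζb u.hom ⟨hu.1, hu.2⟩
    dsimp only at hn
    rw [hζd] at hn
    exact hn.symm
  show (((Ψul).asEquivalence.unitIso.app (ch.obj A)).symm ≪≫ e₀).inv ≫
      (Ψul).inv.map ((naiveFrobeniusCd ch hl).map u.hom) ≫
        (((Ψul).asEquivalence.unitIso.app (ch.obj A)).symm ≪≫ e₀).hom = _
  rw [hmap, Iso.trans_inv, Iso.trans_hom, Iso.symm_inv, Iso.symm_hom, Category.assoc]
  erw [reassoc_of% (unit_inv_map_map hF τ hmt haa hnorm d (ch.lift hl u.hom))]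
  exact hconj

end CharacteristicSplitting

end PreFrobenioid

end Literature.AlgebraicGeometry.Frobenioids
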